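import Literature.Geometry.Lorentzian.CoordTensorCalculus
import Literature.Geometry.Lorentzian.CoordScalarCurvatureEvolution
import Literature.Geometry.Lorentzian.CoordCurvatureNormEvolution
import HarnessLib

/-!
# Iterated covariant derivatives of the Ricci components; their coordinate derivatives

A layer over the rank-generic coordinate tensor calculus (`CoordTensorCalculus.lean`) used by the
conversion of covariant derivative bounds into coordinate derivative bounds in the proof of the
curvature blow-up theorem (Topping 2006, Thm. 5.3.1, p. 47: "by using the consequence of (2.3.3)
… we can check that with respect to local coordinates … (5.3.4)"; Hamilton 1982, §14; the
induction on the order is Chow–Knopf 2004, §6.7). Metric components `G` (`IsMetricOn G V`), a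
basis `b`:

* `tcovIter G b k T` — the **`k`-th iterated covariant derivative** `∇ᵏT` of a component field
  `T` of index type `α`, as a component field of index type `Fin k ⊕ α` (the `k` derivative slots,
  outermost first, then the slots of `T`); `shiftEquiv` relabels `Option (Fin k ⊕ α) ≃ Fin (k+1) ⊕ α`;
  `ric2 G b` — the Ricci form as a rank-two component field `R_{ij} = Ric(b_i, b_j)`.
* **Coordinate derivatives through covariant ones**:
  `IsMetricOn.fderiv_tcovIter_apply` — `∂_j (∇ᵏT)_I = (∇ᵏ⁺¹T)_{jI} + Σ_a Σ_m Γ^m_{jI_a} (∇ᵏT)_{I[a↦m]}`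
  (the definition of `∇`, O'Neill 1983, Ch. 2, Prop. 2.13, read backwards);
  `IsMetricOn.fderiv_metric_apply_basis` — `∂_i g_{jl} = Σ_m (Γ^m_{ij} g_{ml} + Γ^m_{il} g_{jm})`
  (`∇g = 0`); `IsMetricOn.cov₂At_ricAt_basis` — `(∇_j Ric)(b_i, b_d) = (∇Ric)_{j i d}`.
* Families `G : ℝ → E → (E →L E →L ℝ)` (`IsMetricFamilyOn G S V`): joint smoothness in `(y, t)` of
  the components of `∇ᵏT` for jointly smooth `T` (`IsMetricFamilyOn.tsmoothFamOn_tcovIter`) and of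
  `Ric` (`tsmoothFamOn_ric2`); and, **under the coordinate Ricci flow `∂ₜG = −2 Ric(G)`, the time
  derivative of the Christoffel symbols through `∇Ric`**:
  `∂ₜ Γ^m_{ji} = −Σ_d g^{md} ((∇_j Ric)_{id} + (∇_i Ric)_{jd} − (∇_d Ric)_{ji})`
  (`IsMetricFamilyOn.hasDerivWithinAt_chrCoef_of_flow`; Topping 2006, Prop. 2.3.1 with
  `h = −2 Ric`, the tree's `apply_varChrAt_of_flow`).

Everything is proved; no definition of `Prop` type besides the smoothness predicate
`TSmoothFamOn`.

## References

* P. Topping, *Lectures on the Ricci flow*, LMS Lecture Note Series 325, CUP 2006, Prop. 2.3.1,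
  §5.3 (proof of Thm. 5.3.1, p. 47). [Topping2006]
* B. O'Neill, *Semi-Riemannian geometry with applications to relativity*, Academic Press 1983,
  Ch. 2, Prop. 2.13; Ch. 3, Prop. 3.13. [ONeill1983]
* B. Chow, D. Knopf, *The Ricci flow: an introduction*, AMS 2004, §6.7. [ChowKnopf2004]
-/

noncomputable section

set_option maxSynthPendingDepth 3

open Set Filter ContinuousLinearMap Module Function
open scoped Topology ContDiff

namespace Literature.Geometry.Lorentzian

namespace MetricCoord

variable {E : Type*} [NormedAddCommGroup E] [NormedSpace ℝ E] {ι : Type*}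

/-! ### Index bookkeeping: `Option (Fin k ⊕ α) ≃ Fin (k + 1) ⊕ α` -/

section Shift

variable {α : Type*}

/-- The relabelling `Option (Fin k ⊕ α) ≃ Fin (k + 1) ⊕ α`: the new (outermost) derivative slot
`none` becomes slot `0`, the old derivative slots are shifted by one. [folklore] -/
def shiftEquiv (k : ℕ) (α : Type*) : Option (Fin k ⊕ α) ≃ Fin (k + 1) ⊕ α where
  toFun
    | none => Sum.inl 0
    | some (Sum.inl i) => Sum.inl i.succ
    | some (Sum.inr a) => Sum.inr a
  invFun
    | Sum.inl i => Fin.cases none (fun j ↦ some (Sum.inl j)) i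
    | Sum.inr a => some (Sum.inr a)
  left_inv := by
    rintro (_ | i | a)
    · simp
    · simp
    · rfl
  right_inv := by
    rintro (i | a)
    · refine Fin.cases ?_ (fun j ↦ ?_) i
      · simp
      · simp
    · rfl

/-- `shiftEquiv none = inl 0`. [folklore] -/
@[simp] theorem shiftEquiv_none (k : ℕ) : shiftEquiv k α none = Sum.inl 0 := rfl

/-- `shiftEquiv (some (inl i)) = inl i.succ`. [folklore] -/
@[simp] theorem shiftEquiv_some_inl (k : ℕ) (i : Fin k) :
    shiftEquiv k α (some (Sum.inl i)) = Sum.inl i.succ := rfl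

/-- `shiftEquiv (some (inr a)) = inr a`. [folklore] -/
@[simp] theorem shiftEquiv_some_inr (k : ℕ) (a : α) :
    shiftEquiv k α (some (Sum.inr a)) = Sum.inr a := rfl

/-- The index pair `(i, d)` as a function on `Fin 2`. [folklore] -/
def pair (i d : ι) : Fin 2 → ι := ![i, d]

/-- `pair i d 0 = i`. [folklore] -/
@[simp] theorem pair_zero (i d : ι) : pair i d 0 = i := rfl

/-- `pair i d 1 = d`. [folklore] -/
@[simp] theorem pair_one (i d : ι) : pair i d 1 = d := rfl

/-- Updating the first slot of a pair. [folklore] -/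
theorem update_pair_zero (i d m : ι) : update (pair i d) 0 m = pair m d := by
  funext a
  fin_cases a
  · simp
  · rw [update_of_ne (by decide)]; rfl

/-- Updating the second slot of a pair. [folklore] -/
theorem update_pair_one (i d m : ι) : update (pair i d) 1 m = pair i m := by
  funext a
  fin_cases a
  · rw [update_of_ne (by decide)]; rfl
  · simp

end Shift

/-! ### Iterated covariant derivatives and the Ricci components -/

section Iter

variable [Fintype ι] (G : E → E →L[ℝ] E →L[ℝ] ℝ) (b : Basis ι ℝ E) {α : Type*}

/-- **The `k`-th iterated covariant derivative `∇ᵏT` in components**, index type `Fin k ⊕ α`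
(derivative slots outermost first): `∇⁰T = T`, `∇ᵏ⁺¹T = ∇(∇ᵏT)` relabelled along
`shiftEquiv`. [cite: ONeill1983, Ch. 2, Prop. 2.13] -/
def tcovIter [Fintype α] [DecidableEq α] :
    (k : ℕ) → (E → (α → ι) → ℝ) → E → (Fin k ⊕ α → ι) → ℝ
  | 0, T => fun x J ↦ T x (J ∘ Sum.inr)
  | k + 1, T => treindex (shiftEquiv k α) (tcov G b (tcovIter k T))

/-- **The Ricci form as a rank-two component field**: `R_{I₀ I₁} = Ric(b_{I₀}, b_{I₁})`.
[cite: ONeill1983, Ch. 3, Lemma 3.52] -/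
def ric2 [FiniteDimensional ℝ E] (x : E) (I : Fin 2 → ι) : ℝ :=
  ricAt G x (b (I 0)) (b (I 1))

variable {G b}

/-- Unfolding lemma, order zero. [folklore] -/
@[simp] theorem tcovIter_zero_apply [Fintype α] [DecidableEq α] (T : E → (α → ι) → ℝ) (x : E)
    (J : Fin 0 ⊕ α → ι) : tcovIter G b 0 T x J = T x (J ∘ Sum.inr) := rfl

/-- Unfolding lemma, successor: `(∇ᵏ⁺¹T)_J = (∇(∇ᵏT))_{J ∘ shift}`. [folklore] -/
theorem tcovIter_succ_apply [Fintype α] [DecidableEq α] (k : ℕ) (T : E → (α → ι) → ℝ) (x : E)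
    (J : Fin (k + 1) ⊕ α → ι) :
    tcovIter G b (k + 1) T x J = tcov G b (tcovIter G b k T) x (J ∘ shiftEquiv k α) := rfl

/-- `∇(∇ᵏT)` through `∇ᵏ⁺¹T`. [folklore] -/
theorem tcov_tcovIter_apply [Fintype α] [DecidableEq α] (k : ℕ) (T : E → (α → ι) → ℝ) (x : E)
    (J : Option (Fin k ⊕ α) → ι) :
    tcov G b (tcovIter G b k T) x J = tcovIter G b (k + 1) T x (J ∘ (shiftEquiv k α).symm) := by
  rw [tcovIter_succ_apply]
  congr 1
  funext o
  simp

omit [Fintype ι] in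
/-- `ric2` on a pair. [folklore] -/
@[simp] theorem ric2_pair [FiniteDimensional ℝ E] (x : E) (i d : ι) :
    ric2 G b x (pair i d) = ricAt G x (b i) (b d) := rfl

variable {V : Set E} {x : E}

/-- `∇ᵏT` is `C^∞` on `V` when `T` is. [folklore] -/
theorem IsMetricOn.tsmoothOn_tcovIter [CompleteSpace E] [FiniteDimensional ℝ E] [Fintype α]
    [DecidableEq α] (hG : IsMetricOn G V) {T : E → (α → ι) → ℝ} (hT : TSmoothOn T V) (k : ℕ) :
    TSmoothOn (tcovIter G b k T) V := by
  induction k with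
  | zero => exact fun J ↦ hT _
  | succ k ih => exact (hG.tsmoothOn_tcov (b := b) ih).treindex _

omit [Fintype ι] in
/-- The Ricci components are `C^∞` on `V`. [folklore] -/
theorem IsMetricOn.tsmoothOn_ric2 [CompleteSpace E] [FiniteDimensional ℝ E] (hG : IsMetricOn G V) :
    TSmoothOn (ric2 G b) V :=
  fun _ ↦ (hG.contDiffOn_ricAt.clm_apply contDiffOn_const).clm_apply contDiffOn_const

omit [Fintype ι] in
/-- Derivative of a twice-evaluated operator-valued map. [folklore] -/
theorem fderiv_eval₂ {F : E → E →L[ℝ] E →L[ℝ] ℝ} (hF : DifferentiableAt ℝ F x) (v w X : E) :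
    fderiv ℝ (fun y ↦ F y v w) x X = fderiv ℝ F x X v w := by
  have h := (((ContinuousLinearMap.apply ℝ ℝ w).comp
    (ContinuousLinearMap.apply ℝ (E →L[ℝ] ℝ) v)).hasFDerivAt.comp x hF.hasFDerivAt).fderiv
  have hfun : (fun y ↦ F y v w) =
      ⇑((ContinuousLinearMap.apply ℝ ℝ w).comp (ContinuousLinearMap.apply ℝ (E →L[ℝ] ℝ) v)) ∘ F := by
    funext y; rfl
  rw [hfun, h]
  rfl

/-- **Coordinate derivatives of `∇ᵏT` through `∇ᵏ⁺¹T`**: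
`∂_j (∇ᵏT)_I = (∇ᵏ⁺¹T)_{(jI)∘shift⁻¹} + Σ_a Σ_m Γ^m_{j I_a} (∇ᵏT)_{I[a ↦ m]}` (the definition of the
covariant derivative, O'Neill 1983, Ch. 2, Prop. 2.13, read backwards).
[cite: ONeill1983, Ch. 2, Prop. 2.13] -/
theorem fderiv_tcovIter_apply [Fintype α] [DecidableEq α] (k : ℕ) (T : E → (α → ι) → ℝ) (x : E)
    (j : ι) (I : Fin k ⊕ α → ι) :
    fderiv ℝ (fun y ↦ tcovIter G b k T y I) x (b j) =
      tcovIter G b (k + 1) T x (ocons j I ∘ (shiftEquiv k α).symm)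
        + ∑ a, ∑ m, chrCoef G b x j (I a) m * tcovIter G b k T x (update I a m) := by
  rw [← tcov_tcovIter_apply, tcov_apply_ocons]
  ring

/-- **`∇g = 0` in components**: `∂_i g_{jl} = Σ_m (Γ^m_{ij} g_{ml} + Γ^m_{il} g_{jm})`.
[cite: ONeill1983, Ch. 3, Prop. 3.13] -/
theorem IsMetricOn.fderiv_metric_apply_basis [CompleteSpace E] (hG : IsMetricOn G V) (hx : x ∈ V)
    (i j l : ι) :
    fderiv ℝ (fun y ↦ G y (b j) (b l)) x (b i) =
      ∑ m, (chrCoef G b x i j m * G x (b m) (b l) + chrCoef G b x i l m * G x (b j) (b m)) := by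
  rw [hG.fderiv_apply₂ hx, hG.fderiv_eq_chrAt hx, chrAt_basis_eq_sum b x i j, chrAt_basis_eq_sum b x i l,
    Finset.sum_add_distrib]
  simp only [map_sum, map_smul, FunLike.coe_sum, Finset.sum_apply,
    FunLike.coe_smul, Pi.smul_apply, smul_eq_mul]

/-- **`(∇_j Ric)(b_i, b_d)` is the component `(∇Ric)_{j i d}`** of the rank-two field `ric2`.
[cite: ONeill1983, Ch. 2, Prop. 2.13] -/
theorem IsMetricOn.cov₂At_ricAt_basis [CompleteSpace E] [FiniteDimensional ℝ E]
    (hG : IsMetricOn G V) (hx : x ∈ V) (j i d : ι) :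
    cov₂At G (ricAt G) x (b j) (b i) (b d) = tcov G b (ric2 G b) x (ocons j (pair i d)) := by
  rw [cov₂At_apply, tcov_apply_ocons, Fin.sum_univ_two]
  simp only [pair_zero, pair_one, update_pair_zero, update_pair_one, ric2_pair]
  rw [fderiv_eval₂ (hG.differentiableAt_ricAt hx), chrAt_basis_eq_sum b x j i,
    chrAt_basis_eq_sum b x j d]
  simp only [map_sum, map_smul, FunLike.coe_sum, Finset.sum_apply,
    FunLike.coe_smul, Pi.smul_apply, smul_eq_mul]
  ring

omit [Fintype ι] in
/-- The inverse metric coefficients through `ContinuousLinearMap.inverse`: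
`g^{ij} = bⁱ((G x)⁻¹ bʲ)` (`bʲ` the dual basis covector). [folklore] -/
theorem ginv_eq_coord_inverse [FiniteDimensional ℝ E] (x : E) (i j : ι) :
    ginv G b x i j = coordCLM b i ((G x).inverse (coordCLM b j)) := rfl

end Iter

/-! ### Families: joint smoothness, and `∂ₜΓ` under the coordinate Ricci flow -/

/-- **Componentwise joint smoothness in `(y, t)`** of a time-dependent component field on
`V × S`. [folklore] -/
def TSmoothFamOn {α : Type*} (T : ℝ → E → (α → ι) → ℝ) (V : Set E) (S : Set ℝ) : Prop :=
  ∀ I, ContDiffOn ℝ ∞ (fun q : E × ℝ ↦ T q.2 q.1 I) (V ×ˢ S)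

namespace IsMetricFamilyOn

variable [Fintype ι] [FiniteDimensional ℝ E] [CompleteSpace E]
  {G : ℝ → E → E →L[ℝ] E →L[ℝ] ℝ} {S : Set ℝ} {V : Set E} {x : E} {t : ℝ} (b : Basis ι ℝ E) {α : Type*}

omit [Fintype ι] in
/-- The Christoffel symbols of a smooth family are jointly `C^∞` in `(y, t)`. [folklore] -/
theorem contDiffOn_chrCoef_family (hG : IsMetricFamilyOn G S V) (j i m : ι) :
    ContDiffOn ℝ ∞ (fun q : E × ℝ ↦ chrCoef (G q.2) b q.1 j i m) (V ×ˢ S) := by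
  have h' : ContDiffOn ℝ ∞ (fun q : E × ℝ ↦ chrAt (G q.2) q.1 (b j) (b i)) (V ×ˢ S) :=
    (hG.contDiffOn_chrAt_family.clm_apply contDiffOn_const).clm_apply contDiffOn_const
  exact (coordCLM b m).contDiff.comp_contDiffOn h'

omit [Fintype ι] [FiniteDimensional ℝ E] [CompleteSpace E] in
/-- Time-independent relabelling preserves joint smoothness. [folklore] -/
theorem _root_.Literature.Geometry.Lorentzian.MetricCoord.TSmoothFamOn.treindex {β : Type*}
    (e : α ≃ β) {T : ℝ → E → (α → ι) → ℝ} (hT : TSmoothFamOn T V S) :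
    TSmoothFamOn (fun t ↦ treindex e (T t)) V S :=
  fun _ ↦ hT _

/-- **`∇T` of a jointly smooth component family is jointly smooth** (spatial derivatives of a
jointly smooth function are jointly smooth, `contDiffOn_fderiv_slice`, and so are the
Christoffel symbols). [folklore] -/
theorem tsmoothFamOn_tcov [Fintype α] [DecidableEq α] (hG : IsMetricFamilyOn G S V)
    {T : ℝ → E → (α → ι) → ℝ} (hT : TSmoothFamOn T V S) :
    TSmoothFamOn (fun t ↦ tcov (G t) b (T t)) V S := by
  intro J
  by_cases hS : S = ∅
  · simp [hS]
  obtain ⟨t₀, ht₀⟩ := Set.nonempty_iff_ne_empty.mpr hS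
  have hV : IsOpen V := hG.isOpen ht₀
  simp only [tcov_apply]
  refine ContDiffOn.sub ?_ ?_
  · have h1 := contDiffOn_fderiv_slice (F := fun p : E × ℝ ↦ T p.2 p.1 (J ∘ some)) hV hG.uniqueDiffOn
      (hT (J ∘ some))
    exact h1.clm_apply contDiffOn_const
  · refine ContDiffOn.sum fun a _ ↦ ContDiffOn.sum fun m _ ↦ ?_
    exact (hG.contDiffOn_chrCoef_family b _ _ _).mul (hT _)

/-- `∇ᵏT` of a jointly smooth component family is jointly smooth. [folklore] -/
theorem tsmoothFamOn_tcovIter [Fintype α] [DecidableEq α] (hG : IsMetricFamilyOn G S V)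
    {T : ℝ → E → (α → ι) → ℝ} (hT : TSmoothFamOn T V S) (k : ℕ) :
    TSmoothFamOn (fun t ↦ tcovIter (G t) b k (T t)) V S := by
  induction k with
  | zero => exact fun J ↦ hT _
  | succ k ih => exact (hG.tsmoothFamOn_tcov b ih).treindex _

omit [Fintype ι] in
/-- **The Ricci components of a smooth family are jointly smooth** (`Ric(Y,Z) = Σᵢ bⁱ(R(bᵢ,Y)Z)`
and the joint smoothness of `R`, `contDiffOn_riemAt_family`). [cite: Topping2006, §1.2.3] -/
theorem tsmoothFamOn_ric2 (hG : IsMetricFamilyOn G S V) : TSmoothFamOn (fun t ↦ ric2 (G t) b) V S := by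
  intro I
  set c := Module.finBasis ℝ E
  have heq : (fun q : E × ℝ ↦ ric2 (G q.2) b q.1 I) =
      fun q ↦ ∑ i, coordCLM c i (riemAt (G q.2) q.1 (c i) (b (I 0)) (b (I 1))) :=
    funext fun q ↦ ricAt_eq_sum_coord c _ _
  rw [heq]
  exact ContDiffOn.sum fun i _ ↦ (coordCLM c i).contDiff.comp_contDiffOn
    ((hG.contDiffOn_riemAt_family (c i) (b (I 0))).clm_apply contDiffOn_const)

/-- The components `(∇ᵏ Ric)_I` of a smooth family are jointly smooth in `(y, t)`. [folklore] -/
theorem contDiffOn_tcovIter_ric2_family (hG : IsMetricFamilyOn G S V) (k : ℕ)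
    (I : Fin k ⊕ Fin 2 → ι) :
    ContDiffOn ℝ ∞ (fun q : E × ℝ ↦ tcovIter (G q.2) b k (ric2 (G q.2) b) q.1 I) (V ×ˢ S) :=
  hG.tsmoothFamOn_tcovIter b (hG.tsmoothFamOn_ric2 b) k I

section RicciFlow

variable (hG : IsMetricFamilyOn G S V)
  (hfl : ∀ s ∈ S, ∀ y ∈ V, tDeriv G S s y = (-2 : ℝ) • ricAt (G s) y)
include hG hfl

/-- **The time derivative of the Christoffel symbols under the coordinate Ricci flow**
(Topping 2006, Prop. 2.3.1 with `h = −2 Ric`): within `S`,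
`∂ₜ Γ^m_{ji} = −Σ_d g^{md} ((∇_j Ric)(b_i,b_d) + (∇_i Ric)(b_j,b_d) − (∇_d Ric)(b_j,b_i))`.
[cite: Topping2006, Prop. 2.3.1] -/
theorem hasDerivWithinAt_chrCoef_of_flow (ht : t ∈ S) {y : E} (hy : y ∈ V) (j i m : ι) :
    HasDerivWithinAt (fun s ↦ chrCoef (G s) b y j i m)
      (-∑ d, ginv (G t) b y m d * (cov₂At (G t) (ricAt (G t)) y (b j) (b i) (b d)
        + cov₂At (G t) (ricAt (G t)) y (b i) (b j) (b d)
        - cov₂At (G t) (ricAt (G t)) y (b d) (b j) (b i))) S t := by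
  have hi := (hG.isMetricOn t ht).isInvertible y hy
  -- `Γ^m_{ji}(s) = bᵐ(Γ_s(b_j, b_i))`
  have h1 : HasDerivWithinAt (fun s ↦ chrAt (G s) y (b j) (b i)) (varChrAt G S t y (b j) (b i)) S t := by
    have h := ((hG.hasDerivWithinAt_chrAt hy ht).clm_apply (hasDerivWithinAt_const t S (b j)))
    simp only [map_zero, add_zero] at h
    have h' := h.clm_apply (hasDerivWithinAt_const t S (b i))
    simpa using h'
  have h2 := (coordCLM b m).hasFDerivAt.comp_hasDerivWithinAt t h1
  have hval : coordCLM b m (varChrAt G S t y (b j) (b i)) =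
      -∑ d, ginv (G t) b y m d * (cov₂At (G t) (ricAt (G t)) y (b j) (b i) (b d)
        + cov₂At (G t) (ricAt (G t)) y (b i) (b j) (b d)
        - cov₂At (G t) (ricAt (G t)) y (b d) (b j) (b i)) := by
    rw [coordCLM_apply, coord_eq_sum_ginv b hi, ← Finset.sum_neg_distrib]
    refine Finset.sum_congr rfl fun d _ ↦ ?_
    rw [hG.apply_varChrAt_of_flow hfl ht hy]
    ring
  rw [← hval]
  exact h2.congr (fun s _ ↦ rfl) rfl

/-- The same with the components `(∇Ric)_{j i d} = (∇_j Ric)(b_i, b_d)` of `ric2`.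
[cite: Topping2006, Prop. 2.3.1] -/
theorem hasDerivWithinAt_chrCoef_of_flow' (ht : t ∈ S) {y : E} (hy : y ∈ V)
    (j i m : ι) :
    HasDerivWithinAt (fun s ↦ chrCoef (G s) b y j i m)
      (-∑ d, ginv (G t) b y m d * (tcov (G t) b (ric2 (G t) b) y (ocons j (pair i d))
        + tcov (G t) b (ric2 (G t) b) y (ocons i (pair j d))
        - tcov (G t) b (ric2 (G t) b) y (ocons d (pair j i)))) S t := by
  have h := hG.hasDerivWithinAt_chrCoef_of_flow b hfl ht hy j i m
  simp only [(hG.isMetricOn t ht).cov₂At_ricAt_basis hy] at h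
  exact h

end RicciFlow

end IsMetricFamilyOn

end MetricCoord

end Literature.Geometry.Lorentzian

end
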